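import Mathlib
import Summits.Ventures.HodgeRepro2.T5AdicCompletionRamified
import Summits.Ventures.HodgeRepro2.T5LocalNormIndex
import Summits.Ventures.HodgeRepro2.T5NormGroupOpen
import Summits.Ventures.HodgeRepro2.T5RamifiedNormTransfer
import Summits.Ventures.HodgeRepro2.T5ConductorArithmetic

/-!
# The conductor exponent of the norm character `η_v` (T5NormCharConductor)

Setting (rows 139–167 of route/LEAN-ANNEX-p4.md): `K ⊆ L` number fields, `w ∣ v` finite places, `K_v ⊆ L_w`
Mathlib's completions with `[L_w : K_v] = 2`, `σ ≠ 1` in `Gal(L_w/K_v)`, and `η_v := normChar v w σ hind : K_v^× →* ℤˣ`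
the sign character of the index-two norm group `N(L_w^×) ⊆ K_v^×` (row 144; `hind` is row 167's uniform theorem).
The route's Lemma N5.L4 (iv-a) (TIER5 §N5.12) uses the CONDUCTOR of `η_v`: the least `n` with `U_F^{(n)} ⊆ ker η_v`,
written there as `a(η_v) = t + 1` with `t` the ramification break ([FM21-Thm-1.1] at a wild place, `t = 0` at a tame one).

This file defines that exponent on Mathlib's completions, `normCharConductor v w σ ϖ hind := sInf {n | U^{(n)} ⊆ ker η_v}`
(`U^{(n)} = unitFiltration v ϖ n` = the image in `K_v^×` of `higherUnits ϖ n`; `U^{(0)} = O_{K_v}^×`), and proves from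
the rows already in the tree:
* it is well defined — some level lies in the kernel (row 155: every `u` with `v(u − 1) < v(4)` is a norm);
* `U^{(f)} ⊆ ker η_v` and `U^{(n)} ⊄ ker η_v` for `n < f`; `f ≥ 1` at a ramified place (row 167: some unit is not a norm),
  so some `y ∈ U^{(f−1)}` has `η_v(y) = −1`;
* `f ≤ 2e + 1` where `v(2) = exp(−e)` (row 155); `f = 1` at a tame place (rows 144/167); `f ≥ 2` at a wild place (row 167);
* at a ramified place level `t` of `K_v^×` maps into level `2t` of `L_w^×` (`alg ϖ = u·π²`, row 87).

NOT proved here: the exact wild value (`f = d(E_v/F_v)`, the conductor–discriminant formula) — the route's (iv-a)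
only needs `f` with `U^{(f)} ⊆ ker`, `U^{(f−1)} ⊄ ker`, which is what T5RamifiedOddConductor consumes.
-/

namespace Summit.Ventures.HodgeRepro2.T5NormCharConductor

open IsDedekindDomain HeightOneSpectrum
open Summit.Ventures.HodgeRepro2.T5ConductorArithmetic

variable {K : Type*} [Field K] [NumberField K] (v : HeightOneSpectrum (NumberField.RingOfIntegers K))

noncomputable section

/-! ### The principal-unit filtration of `K_v^×` -/

/-- `unitFiltration v ϖ n ⊆ K_v^×`: the image of `higherUnits ϖ n = {r ∈ O_{K_v}^× : ϖ^n ∣ r − 1}` under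
`O_{K_v}^× → K_v^×` (level `0` = all units; level `n ≥ 1` = `1 + 𝔪^n`). -/
def unitFiltration (ϖ : v.adicCompletionIntegers K) (n : ℕ) : Subgroup (v.adicCompletion K)ˣ :=
  Subgroup.map (Units.map (algebraMap (v.adicCompletionIntegers K) (v.adicCompletion K)).toMonoidHom)
    (T5PrincipalUnitFiltration.higherUnits ϖ n)

/-- Membership in level `n`: the image of some `r ∈ higherUnits ϖ n`. -/
theorem mem_unitFiltration {ϖ : v.adicCompletionIntegers K} {n : ℕ} {y : (v.adicCompletion K)ˣ} :
    y ∈ unitFiltration v ϖ n ↔ ∃ r ∈ T5PrincipalUnitFiltration.higherUnits ϖ n,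
      Units.map (algebraMap (v.adicCompletionIntegers K) (v.adicCompletion K)).toMonoidHom r = y :=
  Subgroup.mem_map

/-- The filtration is decreasing. -/
theorem unitFiltration_antitone (ϖ : v.adicCompletionIntegers K) : Antitone (unitFiltration v ϖ) :=
  fun _ _ hmn => Subgroup.map_mono (T5PrincipalUnitFiltration.higherUnits_antitone ϖ hmn)

/-- Level `0` of `higherUnits` is the whole unit group. -/
theorem higherUnits_zero {R : Type*} [CommRing R] (ϖ : R) : T5PrincipalUnitFiltration.higherUnits ϖ 0 = ⊤ := by
  ext r
  simp [T5PrincipalUnitFiltration.mem_higherUnits]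

/-- Level `0` is the unit group `O_{K_v}^× ⊆ K_v^×` (row 135's `adicIntegerUnits`). -/
theorem unitFiltration_zero (ϖ : v.adicCompletionIntegers K) :
    unitFiltration v ϖ 0 = T5AdicCompletionEmbedding.adicIntegerUnits v := by
  rw [unitFiltration, higherUnits_zero, ← MonoidHom.range_eq_map]
  rfl

/-- `y ∈ U^{(0)}` iff `v(y) = 1`. -/
theorem mem_unitFiltration_zero_iff (ϖ : v.adicCompletionIntegers K) (y : (v.adicCompletion K)ˣ) :
    y ∈ unitFiltration v ϖ 0 ↔ Valued.v (y : v.adicCompletion K) = 1 := by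
  rw [unitFiltration_zero]
  exact T5RamifiedNormTransfer.mem_adicIntegerUnits_iff_val_eq_one v y

/-- The coordinate of an integral unit: `↑(Units.map alg r) − 1 = ↑(r − 1)`. -/
theorem coe_map_sub_one (r : (v.adicCompletionIntegers K)ˣ) :
    ((Units.map (algebraMap (v.adicCompletionIntegers K) (v.adicCompletion K)).toMonoidHom r :
        (v.adicCompletion K)ˣ) : v.adicCompletion K) - 1 =
      (((r : v.adicCompletionIntegers K) - 1 : v.adicCompletionIntegers K) : v.adicCompletion K) := by
  rfl

/-- Members of level `n` satisfy `v(y − 1) ≤ exp(−n)`. -/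
theorem val_sub_one_le_of_mem_unitFiltration {ϖ : v.adicCompletionIntegers K} (hϖ : Irreducible ϖ) {n : ℕ}
    {y : (v.adicCompletion K)ˣ} (hy : y ∈ unitFiltration v ϖ n) :
    Valued.v ((y : v.adicCompletion K) - 1) ≤ WithZero.exp (-(n : ℤ)) := by
  obtain ⟨r, hr, rfl⟩ := (mem_unitFiltration v).mp hy
  rw [T5PrincipalUnitFiltration.mem_higherUnits] at hr
  rw [coe_map_sub_one]
  exact (T5AdicCompletionHenselian.pow_dvd_iff_val_le v hϖ _ n).mp hr

/-- A unit `y` of `K_v` (`v(y) = 1`) with `v(y − 1) ≤ exp(−n)` lies in level `n`. -/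
theorem mem_unitFiltration_of_val_sub_one_le {ϖ : v.adicCompletionIntegers K} (hϖ : Irreducible ϖ) {n : ℕ}
    (y : (v.adicCompletion K)ˣ) (hy : Valued.v (y : v.adicCompletion K) = 1)
    (h : Valued.v ((y : v.adicCompletion K) - 1) ≤ WithZero.exp (-(n : ℤ))) : y ∈ unitFiltration v ϖ n := by
  obtain ⟨r, -, rfl⟩ := (mem_unitFiltration v).mp ((mem_unitFiltration_zero_iff v ϖ y).mpr hy)
  refine ⟨r, ?_, rfl⟩
  show r ∈ T5PrincipalUnitFiltration.higherUnits ϖ n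
  rw [T5PrincipalUnitFiltration.mem_higherUnits, T5AdicCompletionHenselian.pow_dvd_iff_val_le v hϖ _ n]
  rw [coe_map_sub_one] at h
  exact h

/-! ### Level doubling at a ramified place -/

section Doubling

variable {L : Type*} [Field L] [NumberField L] [Algebra K L] (w : HeightOneSpectrum (NumberField.RingOfIntegers L))
  [w.asIdeal.LiesOver v.asIdeal]
  [ContinuousSMul (v.adicCompletion K) (w.adicCompletion L)]
  [IsScalarTower K (v.adicCompletion K) (w.adicCompletion L)]

/-- At a ramified place (`alg ϖ = u·π²`, row 87) an integral unit of level `t` in `O_{K_v}` has level `2t` in `O_{L_w}`. -/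
theorem unitsMap_mem_higherUnits_two_mul
    (h2 : Module.finrank (v.adicCompletion K) (w.adicCompletion L) = 2)
    {ϖ : v.adicCompletionIntegers K} (hϖ : Irreducible ϖ) {π : w.adicCompletionIntegers L} (hπ : Irreducible π)
    (hram : ¬ Irreducible (algebraMap (v.adicCompletionIntegers K) (w.adicCompletionIntegers L) ϖ))
    {t : ℕ} {r : (v.adicCompletionIntegers K)ˣ} (hr : r ∈ T5PrincipalUnitFiltration.higherUnits ϖ t) :
    T5PrincipalUnitComparison.unitsMap r ∈ T5PrincipalUnitFiltration.higherUnits π (2 * t) := by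
  obtain ⟨u, hu⟩ := T5AdicCompletionRamified.exists_unit_algebraMap_eq_mul_sq v w h2 hϖ hπ hram
  rw [T5PrincipalUnitFiltration.mem_higherUnits] at hr ⊢
  have hcoe : ((T5PrincipalUnitComparison.unitsMap r : (w.adicCompletionIntegers L)ˣ) : w.adicCompletionIntegers L) - 1 =
      algebraMap (v.adicCompletionIntegers K) (w.adicCompletionIntegers L) ((r : v.adicCompletionIntegers K) - 1) := by
    rw [map_sub, map_one]
    rfl
  rw [hcoe]
  have h1 : (algebraMap (v.adicCompletionIntegers K) (w.adicCompletionIntegers L) ϖ) ^ t ∣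
      algebraMap (v.adicCompletionIntegers K) (w.adicCompletionIntegers L) ((r : v.adicCompletionIntegers K) - 1) := by
    rw [← map_pow]
    exact map_dvd _ hr
  have h2' : π ^ (2 * t) ∣ (algebraMap (v.adicCompletionIntegers K) (w.adicCompletionIntegers L) ϖ) ^ t := by
    rw [hu, mul_pow, pow_mul]
    exact Dvd.intro_left _ rfl
  exact dvd_trans h2' h1

omit [IsScalarTower K (v.adicCompletion K) (w.adicCompletion L)] in
/-- The two routes `O_{K_v}^× → K_v^× → L_w^×` and `O_{K_v}^× → O_{L_w}^× → L_w^×` agree (scalar tower). -/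
theorem baseUnits_map_eq (r : (v.adicCompletionIntegers K)ˣ) :
    T5UnramifiedCharacter.baseUnits v w
        (Units.map (algebraMap (v.adicCompletionIntegers K) (v.adicCompletion K)).toMonoidHom r) =
      Units.map (algebraMap (w.adicCompletionIntegers L) (w.adicCompletion L)).toMonoidHom
        (T5PrincipalUnitComparison.unitsMap r) := by
  apply Units.ext
  show (algebraMap (v.adicCompletion K) (w.adicCompletion L))
      (algebraMap (v.adicCompletionIntegers K) (v.adicCompletion K) (r : v.adicCompletionIntegers K)) =
    (algebraMap (w.adicCompletionIntegers L) (w.adicCompletion L))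
      (algebraMap (v.adicCompletionIntegers K) (w.adicCompletionIntegers L) (r : v.adicCompletionIntegers K))
  rw [← IsScalarTower.algebraMap_apply, ← IsScalarTower.algebraMap_apply]

/-- At a ramified place, `U_F^{(t)}` maps into `U_E^{(2t)}` (the image in `L_w^×` of `higherUnits π (2t)`). -/
theorem baseUnits_mem_map_higherUnits_two_mul
    (h2 : Module.finrank (v.adicCompletion K) (w.adicCompletion L) = 2)
    {ϖ : v.adicCompletionIntegers K} (hϖ : Irreducible ϖ) {π : w.adicCompletionIntegers L} (hπ : Irreducible π)
    (hram : ¬ Irreducible (algebraMap (v.adicCompletionIntegers K) (w.adicCompletionIntegers L) ϖ))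
    {t : ℕ} {y : (v.adicCompletion K)ˣ} (hy : y ∈ unitFiltration v ϖ t) :
    T5UnramifiedCharacter.baseUnits v w y ∈
      Subgroup.map (Units.map (algebraMap (w.adicCompletionIntegers L) (w.adicCompletion L)).toMonoidHom)
        (T5PrincipalUnitFiltration.higherUnits π (2 * t)) := by
  obtain ⟨r, hr, rfl⟩ := (mem_unitFiltration v).mp hy
  rw [baseUnits_map_eq]
  exact ⟨_, unitsMap_mem_higherUnits_two_mul v w h2 hϖ hπ hram hr, rfl⟩

end Doubling

/-! ### The conductor exponent of `η_v` -/

section Conductor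

variable {L : Type*} [Field L] [NumberField L] [Algebra K L] (w : HeightOneSpectrum (NumberField.RingOfIntegers L))
  [w.asIdeal.LiesOver v.asIdeal]
  (σ : (w.adicCompletion L) ≃ₐ[v.adicCompletion K] (w.adicCompletion L))

/-- `K_v` has characteristic zero (it contains the number field `K`). -/
theorem charZero_adicCompletion : CharZero (v.adicCompletion K) :=
  charZero_of_injective_algebraMap (algebraMap K (v.adicCompletion K)).injective

/-- The conductor exponent `f(η_v) := sInf {n | U^{(n)} ⊆ ker η_v}` of the norm character (row 144) at the uniformiser `ϖ`
(T5ConductorArithmetic's `conductor` for the filtration `unitFiltration v ϖ`). -/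
def normCharConductor (ϖ : v.adicCompletionIntegers K)
    (hind : (T5AdicCompletionNormGroup.normGroup v w σ).index = 2) : ℕ :=
  conductor (unitFiltration v ϖ) (T5LocalNormCharacter.normChar v w σ hind)

/-- Unfolding lemma. -/
theorem normCharConductor_eq (ϖ : v.adicCompletionIntegers K)
    (hind : (T5AdicCompletionNormGroup.normGroup v w σ).index = 2) :
    normCharConductor v w σ ϖ hind = conductor (unitFiltration v ϖ) (T5LocalNormCharacter.normChar v w σ hind) :=
  rfl

/-- Some level lies in the kernel of `η_v`: every `u` with `v(u − 1) < v(4)` is a norm (row 155), and level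
`|log v(4)| + 1` is inside that ball. -/
theorem exists_unitFiltration_le_ker {ϖ : v.adicCompletionIntegers K} (hϖ : Irreducible ϖ)
    (hind : (T5AdicCompletionNormGroup.normGroup v w σ).index = 2) :
    ∃ n, unitFiltration v ϖ n ≤ (T5LocalNormCharacter.normChar v w σ hind).ker := by
  haveI : CharZero (v.adicCompletion K) := charZero_adicCompletion v
  have h4 : Valued.v (4 : v.adicCompletion K) ≠ 0 := by
    rw [Valuation.ne_zero_iff]
    exact_mod_cast (by norm_num : (4 : ℕ) ≠ 0)
  refine ⟨(WithZero.log (Valued.v (4 : v.adicCompletion K))).natAbs + 1, fun y hy => ?_⟩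
  rw [MonoidHom.mem_ker, T5LocalNormCharacter.normChar_eq_one_iff]
  apply T5NormGroupOpen.mem_normGroup_of_val_sub_one_lt_val_four
  calc Valued.v ((y : v.adicCompletion K) - 1)
      ≤ WithZero.exp (-(((WithZero.log (Valued.v (4 : v.adicCompletion K))).natAbs + 1 : ℕ) : ℤ)) :=
        val_sub_one_le_of_mem_unitFiltration v hϖ hy
    _ < WithZero.exp (WithZero.log (Valued.v (4 : v.adicCompletion K))) :=
        WithZero.exp_lt_exp.mpr (by omega)
    _ = Valued.v (4 : v.adicCompletion K) := WithZero.exp_log h4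

/-- `U^{(f)} ⊆ ker η_v`. -/
theorem unitFiltration_normCharConductor_le_ker {ϖ : v.adicCompletionIntegers K} (hϖ : Irreducible ϖ)
    (hind : (T5AdicCompletionNormGroup.normGroup v w σ).index = 2) :
    unitFiltration v ϖ (normCharConductor v w σ ϖ hind) ≤ (T5LocalNormCharacter.normChar v w σ hind).ker :=
  Nat.sInf_mem (exists_unitFiltration_le_ker v w σ hϖ hind)

/-- `U^{(n)} ⊄ ker η_v` for `n < f`. -/
theorem not_unitFiltration_le_ker_of_lt (ϖ : v.adicCompletionIntegers K)
    (hind : (T5AdicCompletionNormGroup.normGroup v w σ).index = 2) {n : ℕ}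
    (hn : n < normCharConductor v w σ ϖ hind) :
    ¬ unitFiltration v ϖ n ≤ (T5LocalNormCharacter.normChar v w σ hind).ker :=
  Nat.notMem_of_lt_sInf hn

/-- `f ≤ n` as soon as `U^{(n)} ⊆ ker η_v`. -/
theorem normCharConductor_le_of_le_ker (ϖ : v.adicCompletionIntegers K)
    (hind : (T5AdicCompletionNormGroup.normGroup v w σ).index = 2) {n : ℕ}
    (h : unitFiltration v ϖ n ≤ (T5LocalNormCharacter.normChar v w σ hind).ker) :
    normCharConductor v w σ ϖ hind ≤ n :=
  Nat.sInf_le h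

/-- `U^{(n)} ⊆ ker η_v` as soon as `f ≤ n`. -/
theorem unitFiltration_le_ker_of_normCharConductor_le {ϖ : v.adicCompletionIntegers K} (hϖ : Irreducible ϖ)
    (hind : (T5AdicCompletionNormGroup.normGroup v w σ).index = 2) {n : ℕ}
    (h : normCharConductor v w σ ϖ hind ≤ n) :
    unitFiltration v ϖ n ≤ (T5LocalNormCharacter.normChar v w σ hind).ker :=
  (unitFiltration_antitone v ϖ h).trans (unitFiltration_normCharConductor_le_ker v w σ hϖ hind)

/-- THE BOUND `f ≤ 2e + 1`, `e = v_K(2)` (row 155: `u ≡ 1 (mod 4𝔪)` is a norm). -/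
theorem normCharConductor_le_two_mul_add_one {ϖ : v.adicCompletionIntegers K} (hϖ : Irreducible ϖ)
    (hind : (T5AdicCompletionNormGroup.normGroup v w σ).index = 2) (e : ℕ)
    (he : Valued.v (2 : v.adicCompletion K) = WithZero.exp (-(e : ℤ))) :
    normCharConductor v w σ ϖ hind ≤ 2 * e + 1 := by
  apply normCharConductor_le_of_le_ker
  intro y hy
  rw [MonoidHom.mem_ker, T5LocalNormCharacter.normChar_eq_one_iff]
  apply T5NormGroupOpen.mem_normGroup_of_val_sub_one_lt_val_four
  have h4 : Valued.v (4 : v.adicCompletion K) = WithZero.exp (-(2 * e : ℤ)) := by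
    have : (4 : v.adicCompletion K) = 2 ^ 2 := by norm_num
    rw [this, map_pow, he, sq, ← WithZero.exp_add]
    congr 1
    ring
  calc Valued.v ((y : v.adicCompletion K) - 1) ≤ WithZero.exp (-((2 * e + 1 : ℕ) : ℤ)) :=
        val_sub_one_le_of_mem_unitFiltration v hϖ hy
    _ < WithZero.exp (-(2 * e : ℤ)) := WithZero.exp_lt_exp.mpr (by push_cast; omega)
    _ = Valued.v (4 : v.adicCompletion K) := h4.symm

/-! #### Ramified places: `f ≥ 1`, the level-`(f − 1)` non-norm, tame `f = 1`, wild `f ≥ 2` -/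

/-- At a ramified place `f ≥ 1`: some unit is not a norm (row 167). -/
theorem one_le_normCharConductor (h2 : Module.finrank (v.adicCompletion K) (w.adicCompletion L) = 2) (hσ : σ ≠ 1)
    {ϖ : v.adicCompletionIntegers K} (hϖ : Irreducible ϖ) {π : w.adicCompletionIntegers L} (hπ : Irreducible π)
    (hram : ¬ Irreducible (algebraMap (v.adicCompletionIntegers K) (w.adicCompletionIntegers L) ϖ))
    (hind : (T5AdicCompletionNormGroup.normGroup v w σ).index = 2) :
    1 ≤ normCharConductor v w σ ϖ hind := by
  obtain ⟨u, hu, hun⟩ := T5LocalNormIndex.exists_mem_adicIntegerUnits_notMem_normGroup v w σ h2 hσ hϖ hπ hram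
  by_contra h
  rw [not_le] at h
  have h0 : unitFiltration v ϖ 0 ≤ (T5LocalNormCharacter.normChar v w σ hind).ker :=
    unitFiltration_le_ker_of_normCharConductor_le v w σ hϖ hind (by omega)
  have hmem := h0 (by rw [unitFiltration_zero]; exact hu)
  rw [MonoidHom.mem_ker, T5LocalNormCharacter.normChar_eq_one_iff] at hmem
  exact hun hmem

/-- At a ramified place some `y ∈ U^{(f−1)}` has `η_v(y) = −1` (the level `t = f − 1` of the route's (iv-a)). -/
theorem exists_mem_unitFiltration_pred_normChar_eq_neg_one
    (h2 : Module.finrank (v.adicCompletion K) (w.adicCompletion L) = 2) (hσ : σ ≠ 1)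
    {ϖ : v.adicCompletionIntegers K} (hϖ : Irreducible ϖ) {π : w.adicCompletionIntegers L} (hπ : Irreducible π)
    (hram : ¬ Irreducible (algebraMap (v.adicCompletionIntegers K) (w.adicCompletionIntegers L) ϖ))
    (hind : (T5AdicCompletionNormGroup.normGroup v w σ).index = 2) :
    ∃ y ∈ unitFiltration v ϖ (normCharConductor v w σ ϖ hind - 1),
      T5LocalNormCharacter.normChar v w σ hind y = -1 := by
  have h1 := one_le_normCharConductor v w σ h2 hσ hϖ hπ hram hind
  have hnot := not_unitFiltration_le_ker_of_lt v w σ ϖ hind (n := normCharConductor v w σ ϖ hind - 1) (by omega)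
  rw [SetLike.not_le_iff_exists] at hnot
  obtain ⟨y, hy, hyk⟩ := hnot
  refine ⟨y, hy, ?_⟩
  rw [T5LocalNormCharacter.normChar_eq_neg_one_iff]
  intro hmem
  apply hyk
  rw [MonoidHom.mem_ker, T5LocalNormCharacter.normChar_eq_one_iff]
  exact hmem

/-- TAME: `f = 1` when `2` is a unit (row 144: `η_v` is trivial on `1 + 𝔪` and non-trivial on the units). -/
theorem normCharConductor_eq_one_of_isUnit_two
    (h2 : Module.finrank (v.adicCompletion K) (w.adicCompletion L) = 2) (hσ : σ ≠ 1)
    {ϖ : v.adicCompletionIntegers K} (hϖ : Irreducible ϖ) {π : w.adicCompletionIntegers L} (hπ : Irreducible π)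
    (hram : ¬ Irreducible (algebraMap (v.adicCompletionIntegers K) (w.adicCompletionIntegers L) ϖ))
    (hind : (T5AdicCompletionNormGroup.normGroup v w σ).index = 2) (h2u : IsUnit (2 : v.adicCompletionIntegers K)) :
    normCharConductor v w σ ϖ hind = 1 := by
  apply le_antisymm
  · apply normCharConductor_le_of_le_ker
    intro y hy
    rw [MonoidHom.mem_ker]
    have hy1 : Valued.v (y : v.adicCompletion K) = 1 :=
      (mem_unitFiltration_zero_iff v ϖ y).mp (unitFiltration_antitone v ϖ (Nat.zero_le 1) hy)
    have hy2 : Valued.v ((y : v.adicCompletion K) - 1) < 1 := by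
      refine lt_of_le_of_lt (val_sub_one_le_of_mem_unitFiltration v hϖ hy) ?_
      rw [← WithZero.exp_zero]
      exact WithZero.exp_lt_exp.mpr (by norm_num)
    exact T5LocalNormCharacter.normChar_eq_one_of_val_sub_one_lt_one v w σ hind h2 hϖ hπ hram hσ h2u y hy1 hy2
  · exact one_le_normCharConductor v w σ h2 hσ hϖ hπ hram hind

/-- WILD: `f ≥ 2` when `2` is not a unit (row 167: some principal unit is not a norm). -/
theorem two_le_normCharConductor_of_not_isUnit_two
    (h2 : Module.finrank (v.adicCompletion K) (w.adicCompletion L) = 2) (hσ : σ ≠ 1)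
    {ϖ : v.adicCompletionIntegers K} (hϖ : Irreducible ϖ) {π : w.adicCompletionIntegers L} (hπ : Irreducible π)
    (hram : ¬ Irreducible (algebraMap (v.adicCompletionIntegers K) (w.adicCompletionIntegers L) ϖ))
    (hind : (T5AdicCompletionNormGroup.normGroup v w σ).index = 2)
    (h2n : ¬ IsUnit (2 : v.adicCompletionIntegers K)) :
    2 ≤ normCharConductor v w σ ϖ hind := by
  obtain ⟨y, hy, hyn⟩ :=
    T5LocalNormIndex.exists_val_sub_one_lt_one_notMem_normGroup v w σ h2 hσ hϖ hπ hram h2n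
  by_contra h
  rw [not_le] at h
  have h1 : unitFiltration v ϖ 1 ≤ (T5LocalNormCharacter.normChar v w σ hind).ker :=
    unitFiltration_le_ker_of_normCharConductor_le v w σ hϖ hind (by omega)
  apply hyn
  rw [← T5LocalNormCharacter.normChar_eq_one_iff v w σ hind, ← MonoidHom.mem_ker]
  apply h1
  have hlt : Valued.v ((y : v.adicCompletion K) - 1) < Valued.v (1 : v.adicCompletion K) := by
    rw [map_one]
    exact hy
  apply mem_unitFiltration_of_val_sub_one_le v hϖ y
  · have := Valuation.map_add_eq_of_lt_right Valued.v hlt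
    rw [sub_add_cancel, map_one] at this
    exact this
  · have hne : (y : v.adicCompletion K) - 1 ≠ 0 := by
      intro h0
      apply hyn
      have hy1 : y = 1 := Units.ext (sub_eq_zero.mp h0)
      rw [hy1]
      exact one_mem _
    have hv0 : Valued.v ((y : v.adicCompletion K) - 1) ≠ 0 := (Valuation.ne_zero_iff _).mpr hne
    rw [← WithZero.exp_log hv0] at hy ⊢
    rw [← WithZero.exp_zero, WithZero.exp_lt_exp] at hy
    exact WithZero.exp_le_exp.mpr (by omega)

end Conductor

end

end Summit.Ventures.HodgeRepro2.T5NormCharConductor
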